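import Summits.ResolutionOfSingularities.ResolutionOfSingularities.Theorems.RadicialJungCleanModelsLocalMonomializationAlongCoarsening
import Summits.ResolutionOfSingularities.ResolutionOfSingularities.Theorems.RadicialJungCleanModelsCcurveRebaseField
import Literature.AlgebraicGeometry.Resolution.RankOneReductionProofs
import Literature.AlgebraicGeometry.Resolution.AffineModelLU
import HarnessLib

/-!
# Novacoski–Spivakovsky Cor. 2.17 in TRANSPORT form: lifting a `ν₂`-model of the residue field to a model inside `O`, keeping the local ring at the centre of `ν₁` and surjecting onto the residue local ring

Route `RadicialJung`, crux `CleanModels` (stmt-ResolutionOfSingularities-15917), registered skeleton `Cruxes/CleanModels/Lines/Sketch.lean`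
rev 35 (sha16 de44649d8f729c3b), stub 7 `stub_cleanModelsDimGEFour`.  Explicit-unit seat `decomp-res-hand-2` g4 (structural hand); memo
`Cruxes/CleanModels/Lines/Sketch-memo-hand2-g4-stubs-5-7.md` §5 item (3a).  OURS; structural bookkeeping, counted 0; nothing here proves resolution
of singularities in characteristic `p`.

The tree's ✓ `novacoskiSpivakovsky2014_cor217` (`Literature/…/RankOneReductionProofs.lean`) proves Novacoski–Spivakovsky's Cor. 2.17
(arXiv:1204.4751: for `ν = ν₁ ∘ ν₂`, a `ν₂`-model `B` of the residue field above `φ(A)` lifts to a model `A' = A[fa b / fs b] ⊆ O`) and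
records its two REGULARITY consequences.  For the WEAK EMBEDDED version of the rank-one reduction (Thm. 1.2, §3.2) one needs the
construction's TRANSPORT properties instead, so that ANY data living in the local ring of `B` at the centre of `ν₂` (a regular system of
parameters `x̄`, units `ū`, monomial expressions `w̄ = ū x̄^δ`) acquires representatives in the local ring of `A'` at the centre of `ν`, well
defined modulo `{ν₁ < 1}`.  This file re-runs the construction (same model, same lifts; credit to the original file) and records, for an
ARBITRARY property `P` of the residue-side model (a parameter — instantiate with «regular + monomial data», e.g. hand-2 g4's
✓ `weakEmbeddedLU_residueSide_dimLEFour`):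

* `cor217_transport` — ∃ finitely generated `A ≤ A' ⊆ O` and residue data `(κ, ι, φ, B)` with `P κ ι B`, such that
  (α) `locAtCentre A' O₁ = locAtCentre A O₁` (the local ring at the centre of `ν₁` is unchanged, NS Lemma 2.15 / 2.5 (1));
  (β) the residue map sends `locAtCentre A' O` ONTO `ι (locAtCentre B (ν₂-ring))` — every element of the local ring of `B` at the centre of
  `ν₂` is the residue of an element of the local ring of `A'` at the centre of `ν`, and conversely.
[cite: NovacoskiSpivakovsky2014, Lemma 2.15, Def. 2.16, Cor. 2.17]
-/

noncomputable section

set_option linter.dupNamespace false -- mandated namespace of this single-conjunct summit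

open IsLocalRing
open Literature.AlgebraicGeometry.Resolution
open Summit.ResolutionOfSingularities.ResolutionOfSingularities.Theorems.SwitchingDichotomy

namespace Summit.ResolutionOfSingularities.ResolutionOfSingularities.Theorems.RadicialJung.CleanModels

variable {k K : Type} [Field k] [Field K] [Algebra k K]

set_option maxHeartbeats 800000 in
/-- **Novacoski–Spivakovsky 2014, Cor. 2.17, transport form** (see the module docstring).  For `O ≤ O₁`, a finitely generated `A ⊆ O`
(`Frac A = K` is not needed), and a residue-side hypothesis `h₂` producing, for every residue presentation `(κ, ι, φ)` of `A`, a finitely generated model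
`φ(A) ≤ B` of `κ` inside the valuation ring of `ν₂` with property `P κ ι B`: there are a finitely generated `A ≤ A' ⊆ O` and such data
`(κ, ι, φ, B)` with `P κ ι B`, `locAtCentre A' O₁ = locAtCentre A O₁`, and the residue map of `O₁` carrying `locAtCentre A' O` onto
`ι (locAtCentre B ((residueValuationSubring O O₁).comap ι))`.  Construction verbatim from ✓ `novacoskiSpivakovsky2014_cor217`: generators
`b = φ(a)/φ(s)` of `B` are lifted to `fa b / fs b ∈ O` (`fs b ∉ 𝔭`), `A' = A ⊔ k[lifts]`. [cite: NovacoskiSpivakovsky2014, Lemma 2.15 and Cor. 2.17] -/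
theorem cor217_transport (O O₁ : ValuationSubring K) (hO : O ≤ O₁)
    (A : Subalgebra k K) (hA : A.toSubring ≤ O.toSubring) (hAfg : A.FG)
    (P : ∀ (κ : Type) [Field κ] [Algebra k κ], (κ →+* ResidueField O₁) → Subalgebra k κ → Prop)
    (h₂ : ∀ (κ : Type) [Field κ] [Algebra k κ] (ι : κ →+* ResidueField O₁) (φ : A →ₐ[k] κ),
      (∀ a : A, ι (φ a) = residue O₁ ⟨(a : K), (hA.trans hO) a.2⟩) →
      IsFractionRing φ.range κ →
      ∃ (B : Subalgebra k κ), B.toSubring ≤ ((residueValuationSubring O O₁ hO).comap ι).toSubring ∧ φ.range ≤ B ∧ B.FG ∧ P κ ι B) :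
    ∃ (A' : Subalgebra k K) (hA' : A'.toSubring ≤ O.toSubring), A ≤ A' ∧ A'.FG ∧
      locAtCentre A'.toSubring O₁ = locAtCentre A.toSubring O₁ ∧
      ∃ (κ : Type) (_ : Field κ) (_ : Algebra k κ) (ι : κ →+* ResidueField O₁) (φ : A →ₐ[k] κ) (B : Subalgebra k κ)
        (_ : B.toSubring ≤ ((residueValuationSubring O O₁ hO).comap ι).toSubring),
        (∀ a : A, ι (φ a) = residue O₁ ⟨(a : K), (hA.trans hO) a.2⟩) ∧ φ.range ≤ B ∧ P κ ι B ∧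
        (∀ x (hx : x ∈ locAtCentre A'.toSubring O), ∃ b ∈ locAtCentre B.toSubring ((residueValuationSubring O O₁ hO).comap ι),
          residue O₁ ⟨x, hO (locAtCentre_le hA' hx)⟩ = ι b) ∧
        (∀ b ∈ locAtCentre B.toSubring ((residueValuationSubring O O₁ hO).comap ι), ∃ x, ∃ hx : x ∈ locAtCentre A'.toSubring O,
          residue O₁ ⟨x, hO (locAtCentre_le hA' hx)⟩ = ι b) := by
  classical
  have hAO₁ : A.toSubring ≤ O₁.toSubring := hA.trans hO
  set O₂ := residueValuationSubring O O₁ hO with hO₂def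
  set Pc := ((maximalIdeal O₁).comap (Subring.inclusion hAO₁)) with hPcdef
  let φ : A.toSubring →+* ResidueField O₁ := ((residue O₁).comp (Subring.inclusion hAO₁))
  -- the residue field `κ = Frac (A / 𝔭)` inside `κ(O₁)`, with its `k`-structure
  let κ : Subfield (ResidueField O₁) := Subfield.closure (Set.range φ)
  have hφκ : ∀ a, φ a ∈ κ := fun a => Subfield.subset_closure ⟨a, rfl⟩
  let φκ : A →+* κ := (φ.codRestrict κ.toSubring hφκ : A.toSubring →+* κ)
  letI : Algebra k κ := (φκ.comp (algebraMap k A)).toAlgebra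
  let φₐ : A →ₐ[k] κ := { φκ with commutes' := fun c => rfl }
  let ι : κ →+* ResidueField O₁ := κ.subtype
  set O₂' := O₂.comap ι with hO₂'def
  have hφO₂ : ∀ a : A, φ a ∈ O₂ := fun a =>
    (residue_mem_residueValuationSubring_iff O O₁ hO _).mpr (hA a.2)
  have hφunit : ∀ s : A, s ∉ Pc → O₁.valuation (s : K) = 1 := fun s hs =>
    (mem_primeCompl_centre_iff O₁ A hAO₁ s).mp hs
  -- the model `B₀ = φ(A)` of `κ`
  let B₀ : Subalgebra k κ := φₐ.range
  have hmemB₀ : ∀ x : κ, x ∈ B₀ ↔ ∃ a : A, φκ a = x := fun x => AlgHom.mem_range φₐ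
  have hrange : (Subring.closure (Set.range φ)) = φ.range := by
    rw [← RingHom.coe_range, Subring.closure_eq]
  haveI hB₀frac : IsFractionRing B₀ κ := by
    apply IsFractionRing.of_field
    rintro ⟨z, hz⟩
    rw [Subfield.mem_closure_iff] at hz
    obtain ⟨y, hy, w, hw, rfl⟩ := hz
    rw [hrange] at hy hw
    obtain ⟨a, rfl⟩ := hy
    obtain ⟨b, rfl⟩ := hw
    refine ⟨⟨φκ a, (hmemB₀ _).mpr ⟨a, rfl⟩⟩, ⟨φκ b, (hmemB₀ _).mpr ⟨b, rfl⟩⟩, ?_⟩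
    apply Subtype.ext
    rfl
  -- the residue-side model `B`
  obtain ⟨B, hB, hB₀B, hBfg, hPB⟩ := h₂ κ ι φₐ (fun _ => rfl) hB₀frac
  obtain ⟨tB, htB⟩ := hBfg
  -- lifting elements of `κ` to fractions `a / s`, `s ∉ 𝔭`
  have hlift : ∀ b : κ, ∃ a s : A, s ∉ Pc ∧ (b : ResidueField O₁) = φ a / φ s := by
    rintro ⟨z, hz⟩
    rw [Subfield.mem_closure_iff] at hz
    obtain ⟨y, hy, w, hw, rfl⟩ := hz
    rw [hrange] at hy hw
    obtain ⟨a, rfl⟩ := hy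
    obtain ⟨s, rfl⟩ := hw
    by_cases hs : s ∈ Pc
    · refine ⟨0, 1, ?_, ?_⟩
      · exact Pc.primeCompl.one_mem
      · have : φ s = 0 := (residue_inclusion_eq_zero_iff O₁ A hAO₁ s).mpr hs
        simp [this]
    · exact ⟨a, s, hs, rfl⟩
  choose fa fs hfs hlift using hlift
  let g : κ → K := fun b => (fa b : K) / (fs b : K)
  have hgO₁ : ∀ b, g b ∈ O₁ := fun b => by
    simp only [g, div_eq_mul_inv]
    exact mul_mem (hAO₁ (fa b).2) (inv_mem_of_valuation_eq_one O₁ (hφunit _ (hfs b)))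
  have hgres : ∀ b, residue O₁ ⟨g b, hgO₁ b⟩ = (b : ResidueField O₁) := fun b => by
    rw [hlift b]
    exact residue_div O₁ _ _ (hAO₁ (fa b).2) (hAO₁ (fs b).2) (hφunit _ (hfs b)) _
  have hgO : ∀ b : κ, b ∈ B → g b ∈ O := fun b hb => by
    rw [← residue_mem_residueValuationSubring_iff O O₁ hO ⟨g b, hgO₁ b⟩, hgres b]
    exact hB hb
  -- the new model `A' = A[g(tB)]`
  let A' : Subalgebra k K := A ⊔ Algebra.adjoin k (tB.image g : Set K)
  have hk : ∀ c : k, algebraMap k K c ∈ O := fun c => hA (A.algebraMap_mem c)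
  have htBB : ∀ b ∈ tB, b ∈ B := fun b hb => by rw [← htB]; exact Algebra.subset_adjoin hb
  have hA'O : A'.toSubring ≤ O.toSubring := by
    have : A' ≤ ({ O.toSubring with algebraMap_mem' := hk } : Subalgebra k K) := by
      refine sup_le (fun x hx => hA hx) (Algebra.adjoin_le ?_)
      intro x hx
      rw [Finset.coe_image] at hx
      obtain ⟨b, hb, rfl⟩ := hx
      exact hgO b (htBB b hb)
    exact fun x hx => this hx
  have hAA' : A ≤ A' := le_sup_left
  have hA'fg : A'.FG := hAfg.sup ⟨_, rfl⟩
  have hA'O₁ : A'.toSubring ≤ O₁.toSubring := hA'O.trans hO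
  -- (α) the local ring at the centre of `ν₁` is unchanged: generators `g b = fa b / fs b` lie in `locAtCentre A O₁`
  have hα : locAtCentre A'.toSubring O₁ = locAtCentre A.toSubring O₁ := by
    refine locAtCentre_eq_of_mutual_le O₁ A'.toSubring A.toSubring ?_ (fun x hx => le_locAtCentre _ _ (hAA' hx))
    let L : Subalgebra k K :=
      ({ locAtCentre A.toSubring O₁ with
          algebraMap_mem' := fun c => le_locAtCentre A.toSubring O₁ (A.algebraMap_mem c) } : Subalgebra k K)
    have : A' ≤ L := by
      refine sup_le (fun x hx => le_locAtCentre A.toSubring O₁ hx) (Algebra.adjoin_le ?_)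
      intro x hx
      rw [Finset.coe_image] at hx
      obtain ⟨b, -, rfl⟩ := hx
      exact ⟨fa b, (fa b).2, fs b, (fs b).2, hφunit _ (hfs b), rfl⟩
    exact fun x hx => this hx
  -- `ψ = residue ∘ (A' ⊆ O₁)` maps `A'` into `ι(B)`
  let ψ : A'.toSubring →+* ResidueField O₁ := ((residue O₁).comp (Subring.inclusion hA'O₁))
  have hψB : ∀ x : A'.toSubring, ∃ b : κ, b ∈ B ∧ ψ x = b := by
    let T : Subalgebra k K :=
      { (((B.toSubring.map ι).comap (residue O₁)).map O₁.toSubring.subtype) with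
        algebraMap_mem' := fun c => by
          change algebraMap k K c ∈ (((B.toSubring.map ι).comap (residue O₁)).map O₁.toSubring.subtype)
          rw [mem_map_subtype_comap_residue_iff]
          refine ⟨hAO₁ (A.algebraMap_mem c), ?_⟩
          rw [Subring.mem_map]
          exact ⟨φκ ⟨algebraMap k K c, A.algebraMap_mem c⟩, hB₀B ((hmemB₀ _).mpr ⟨_, rfl⟩), rfl⟩ }
    have hA'T : A' ≤ T := by
      refine sup_le (fun x hx => ?_) (Algebra.adjoin_le fun x hx => ?_)
      · change x ∈ (((B.toSubring.map ι).comap (residue O₁)).map O₁.toSubring.subtype)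
        rw [mem_map_subtype_comap_residue_iff]
        refine ⟨hAO₁ hx, ?_⟩
        rw [Subring.mem_map]
        exact ⟨φκ ⟨x, hx⟩, hB₀B ((hmemB₀ _).mpr ⟨_, rfl⟩), rfl⟩
      · rw [Finset.coe_image] at hx
        obtain ⟨b, hb, rfl⟩ := hx
        change g b ∈ (((B.toSubring.map ι).comap (residue O₁)).map O₁.toSubring.subtype)
        rw [mem_map_subtype_comap_residue_iff]
        refine ⟨hgO₁ b, ?_⟩
        rw [Subring.mem_map, hgres b]
        exact ⟨b, htBB b hb, rfl⟩
    intro x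
    have hx := hA'T x.2
    change (x : K) ∈ (((B.toSubring.map ι).comap (residue O₁)).map O₁.toSubring.subtype) at hx
    rw [mem_map_subtype_comap_residue_iff] at hx
    obtain ⟨hx₁, hx₂⟩ := hx
    rw [Subring.mem_map] at hx₂
    obtain ⟨b, hb, hb'⟩ := hx₂
    exact ⟨b, hb, hb'.symm⟩
  -- `ψ` maps `A'` ONTO `B`
  let ψκ : A' →ₐ[k] κ :=
    { toFun := fun x => ⟨ψ x, by obtain ⟨b, -, hb⟩ := hψB x; rw [hb]; exact b.2⟩
      map_one' := Subtype.ext (map_one ψ)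
      map_mul' := fun x y => Subtype.ext (map_mul ψ x y)
      map_zero' := Subtype.ext (map_zero ψ)
      map_add' := fun x y => Subtype.ext (map_add ψ x y)
      commutes' := fun c => Subtype.ext rfl }
  have hBψ : ∀ b : κ, b ∈ B → ∃ x : A'.toSubring, ψ x = b := by
    have hle : B ≤ ψκ.range := by
      rw [← htB]
      refine Algebra.adjoin_le fun b hb => ?_
      have hgb : g b ∈ A' := by
        apply (le_sup_right : Algebra.adjoin k _ ≤ A')
        apply Algebra.subset_adjoin
        rw [Finset.coe_image]; exact ⟨b, hb, rfl⟩
      refine ⟨⟨g b, hgb⟩, Subtype.ext ?_⟩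
      exact hgres b
    intro b hb
    obtain ⟨x, hx⟩ := hle hb
    exact ⟨x, congrArg Subtype.val hx⟩
  -- units: `ν(s) = 1` iff the residue of `s` is a `ν₂`-unit
  have hBO₂' : ∀ b : κ, b ∈ B → b ∈ O₂' := fun b hb => hB hb
  have hunit_iff : ∀ (s : K) (hs : s ∈ O) (b : κ) (hb : b ∈ B), residue O₁ ⟨s, hO hs⟩ = ι b →
      (O.valuation s = 1 ↔ O₂'.valuation b = 1) := by
    intro s hs b hb hsb
    have h1 : O.valuation s < 1 ↔ O₂'.valuation b < 1 := by
      rw [valuation_lt_one_iff_residue O O₁ hO s hs, hsb, hO₂'def, valuation_comap_lt_one_iff]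
    constructor
    · intro h
      have : ¬ O₂'.valuation b < 1 := fun hlt => (lt_irrefl _) (h ▸ h1.mpr hlt)
      exact le_antisymm ((O₂'.valuation_le_one_iff b).mpr (hBO₂' b hb)) (not_lt.mp this)
    · intro h
      have : ¬ O.valuation s < 1 := fun hlt => (lt_irrefl _) (h ▸ h1.mp hlt)
      exact le_antisymm ((O.valuation_le_one_iff s).mpr hs) (not_lt.mp this)
  refine ⟨A', hA'O, hAA', hA'fg, hα, κ, inferInstance, inferInstance, ι, φₐ, B, hB, fun _ => rfl, hB₀B, hPB, ?_, ?_⟩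
  · -- (β, first half) residues of `locAtCentre A' O` lie in `ι (locAtCentre B O₂')`
    intro x hx
    obtain ⟨a, ha, s, hs, hvs, rfl⟩ := hx
    obtain ⟨ba, hba, hψa⟩ := hψB ⟨a, ha⟩
    obtain ⟨bs, hbs, hψs⟩ := hψB ⟨s, hs⟩
    have hsO : s ∈ O := hA'O hs
    have haO : a ∈ O := hA'O ha
    have hψs' : residue O₁ ⟨s, hO hsO⟩ = ι bs := hψs
    have hvs₂ : O₂'.valuation bs = 1 := (hunit_iff s hsO bs hbs hψs').mp hvs
    refine ⟨ba / bs, ⟨ba, hba, bs, hbs, hvs₂, rfl⟩, ?_⟩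
    have hs1 : O₁.valuation s = 1 := Shannon.valuation_eq_one_of_le hO hvs
    rw [residue_div O₁ a s (hO haO) (hO hsO) hs1, map_div₀]
    exact congrArg₂ (· / ·) hψa hψs
  · -- (β, second half) every element of `locAtCentre B O₂'` is the residue of an element of `locAtCentre A' O`
    intro b hb
    obtain ⟨b₁, hb₁, u, hu, hu1, rfl⟩ := hb
    obtain ⟨x₁, hx₁⟩ := hBψ b₁ hb₁
    obtain ⟨xu, hxu⟩ := hBψ u hu
    have hx₁O : (x₁ : K) ∈ O := hA'O x₁.2
    have hxuO : (xu : K) ∈ O := hA'O xu.2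
    have hxu' : residue O₁ ⟨(xu : K), hO hxuO⟩ = ι u := hxu
    have hvu : O.valuation (xu : K) = 1 := (hunit_iff (xu : K) hxuO u hu hxu').mpr hu1
    refine ⟨(x₁ : K) / (xu : K), ⟨x₁, x₁.2, xu, xu.2, hvu, rfl⟩, ?_⟩
    have hu1' : O₁.valuation (xu : K) = 1 := Shannon.valuation_eq_one_of_le hO hvu
    rw [residue_div O₁ (x₁ : K) (xu : K) (hO hx₁O) (hO hxuO) hu1', map_div₀]
    exact congrArg₂ (· / ·) hx₁ hxu

end Summit.ResolutionOfSingularities.ResolutionOfSingularities.Theorems.RadicialJung.CleanModels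

end
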